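import Literature.Analysis.Complex.WeylLemmaDbar
import Literature.Analysis.Complex.DbarAlongCalculus
import Mathlib.MeasureTheory.Measure.Haar.NormedSpace
import HarnessLib

/-!
# Schwarz reflection for a one-phase boundary measure (crux `BoundaryClosureR`,
# stmt-CriticalPhenomena-14004, line `polygon-parity-squeeze`, sub-goal (A2) of
# `stub_polygonIdentification`)

Let `B = B(x₀, r)` be a disc centred on the real axis, `B⁺ = B ∩ {Im z > 0}`, and let `H` be
holomorphic and integrable on `B⁺`.  Suppose the distributional `∂̄` of `H 1_{B⁺}` inside `B` is a
ONE-PHASE measure carried by the diameter: for some finite positive measure `ν` on `ℝ` and some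
phase `θ`, `∫_{B⁺} H ∂̄φ dA = e^{iθ} ∫ φ(x) dν(x)` for every test function `φ ∈ C_c^∞(B)`.  Then `H`
extends to a holomorphic function on the whole disc `B`.

Proof (folklore, the Schwarz reflection principle in distributional form).  Put `α = i e^{-iθ}`,
`H₁ = α H`, so that `∫_{B⁺} H₁ ∂̄φ = i ∫ φ dν`.  Let `f = f₁ + f₂` with `f₁ = H₁ 1_{B⁺}` and
`f₂(z) = conj (f₁ (conj z))` (the reflection of `f₁` to the lower half disc).  For a test function
`φ` supported in `B`, the reflected test function `φ*(w) = conj (φ (conj w))` is again supported in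
`B` and `∂̄φ* (w) = conj ((∂̄φ)(conj w))`; the change of variables `z = conj w` (a measure preserving
isometry of `ℂ`) gives `∫ f₂ ∂̄φ = conj (∫ f₁ ∂̄φ*) = conj (i ∫ conj φ dν) = -i ∫ φ dν`, because
`ν` is a positive measure.  Hence `∫ f ∂̄φ = 0` for all test functions supported in `B`, i.e.
`∂̄ f = 0` in `D'(B)`, and Weyl's lemma for `∂̄` (`Literature.Analysis.Complex.weyl_dbar`) produces
a holomorphic `g` on `B` with `f = g` a.e.; on the open set `B⁺` both `g` and `H₁ = f` are
continuous, so `g = H₁` there, and `G = α⁻¹ g` is the required extension.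
-/

noncomputable section

open scoped Topology ContDiff ComplexConjugate
open Filter Set MeasureTheory Metric Complex Literature.Analysis.Complex

namespace Summit.CriticalPhenomena.SAWScalingLimit.Theorems.PolygonParitySqueeze

/-- **`∂̄` of a reflected test function.**  For `φ* (z) = conj (φ (conj z))` one has
`∂̄φ* (w) = conj ((∂̄φ)(conj w))` (chain rule: the real derivative of `conj` is `conj`, and
`conj i = -i`). [folklore] -/
theorem dbarAlong_one_conj_comp_conj {φ : ℂ → ℂ} {w : ℂ} (hφ : DifferentiableAt ℝ φ (conj w)) :
    dbarAlong 1 (fun z => conj (φ (conj z))) w = conj (dbarAlong 1 φ (conj w)) := by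
  have h1 : HasFDerivAt (fun z : ℂ => conj z) (conjCLE : ℂ →L[ℝ] ℂ) w := conjCLE.hasFDerivAt
  have h3 : HasFDerivAt (fun z => φ (conj z))
      ((fderiv ℝ φ (conj w)).comp (conjCLE : ℂ →L[ℝ] ℂ)) w :=
    hφ.hasFDerivAt.comp w h1
  have h4 : HasFDerivAt (fun z => conj (φ (conj z)))
      ((conjCLE : ℂ →L[ℝ] ℂ).comp ((fderiv ℝ φ (conj w)).comp (conjCLE : ℂ →L[ℝ] ℂ))) w :=
    conjCLE.hasFDerivAt.comp w h3
  rw [dbarAlong_one, dbarAlong_one, h4.fderiv]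
  simp only [ContinuousLinearMap.coe_comp, ContinuousLinearEquiv.coe_coe, Function.comp_apply,
    conjCLE_apply, map_one, conj_I, map_neg, smul_eq_mul, map_mul, map_add, map_inv₀, map_ofNat]
  ring

/-- **Reflection change of variables.**  `∫ conj (k (conj z)) ψ(z) dA(z) =
conj (∫ k(w) conj (ψ (conj w)) dA(w))`: complex conjugation `z ↦ conj z` is a measure preserving
isometry of `ℂ`. [folklore] -/
theorem integral_conj_comp_conj_mul (k ψ : ℂ → ℂ) :
    ∫ z, conj (k (conj z)) * ψ z = conj (∫ w, k w * conj (ψ (conj w))) := by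
  set g : ℂ → ℂ := fun w => k w * conj (ψ (conj w)) with hg
  have h1 : (fun z => conj (k (conj z)) * ψ z) = fun z => conj (g (conjLIE z)) := by
    ext z
    simp [hg, map_mul]
  rw [h1, integral_conj, MeasureTheory.integral_comp conjLIE g]

/-- The reflection `z ↦ conj (k (conj z))` of an integrable function on `ℂ` is integrable.
[folklore] -/
theorem integrable_conj_comp_conj {k : ℂ → ℂ} (hk : Integrable k) :
    Integrable fun z => conj (k (conj z)) := by
  have h1 : Integrable (k ∘ conjLIE) := (MeasureTheory.integrable_comp conjLIE k).2 hk
  have h2 := (conjCLE : ℂ →L[ℝ] ℂ).integrable_comp h1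
  simpa using h2

/-- **Schwarz reflection for a one-phase boundary measure** (sub-goal (A2) of
`stub_polygonIdentification`, line `polygon-parity-squeeze`).  If `H` is holomorphic and integrable
on the upper half disc `B(x₀, r) ∩ {Im z > 0}` (`x₀` real) and, as a distribution on `B(x₀, r)`,
`∫_{B⁺} H ∂̄φ dA = e^{iθ} ∫ φ(x) dν(x)` for a finite positive measure `ν` on `ℝ` and a constant
phase `θ`, then `H` is the restriction of a function holomorphic on the whole disc `B(x₀, r)`
(distributional Schwarz reflection + Weyl's lemma for `∂̄`). [folklore] -/
theorem schwarzReflection_of_boundaryMeasure : ∀ (H : ℂ → ℂ) (x₀ r : ℝ), 0 < r → DifferentiableOn ℂ H (Metric.ball (x₀ : ℂ) r ∩ {z : ℂ | 0 < z.im}) → MeasureTheory.IntegrableOn H (Metric.ball (x₀ : ℂ) r ∩ {z : ℂ | 0 < z.im}) → (∃ (ν : MeasureTheory.Measure ℝ) (θ : ℝ), MeasureTheory.IsFiniteMeasure ν ∧ ∀ φ : ℂ → ℂ, ContDiff ℝ ∞ φ → HasCompactSupport φ → tsupport φ ⊆ Metric.ball (x₀ : ℂ) r → ∫ z in Metric.ball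 (x₀ : ℂ) r ∩ {z : ℂ | 0 < z.im}, H z * Literature.Analysis.Complex.dbarAlong 1 φ z = Complex.exp (θ * Complex.I) * ∫ x : ℝ, φ (x : ℂ) ∂ν) → ∃ G : ℂ → ℂ, DifferentiableOn ℂ G (Metric.ball (x₀ : ℂ) r) ∧ Set.EqOn G H (Metric.ball (x₀ : ℂ) r ∩ {z : ℂ | 0 < z.im}) := by
  intro H x₀ r _hr hHd hHi hbd
  obtain ⟨ν, θ, _hν, hid⟩ := hbd
  -- notation
  set B : Set ℂ := ball (x₀ : ℂ) r with hB
  set Bp : Set ℂ := B ∩ {z : ℂ | 0 < z.im} with hBp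
  have hBo : IsOpen B := isOpen_ball
  have hBpo : IsOpen Bp := isOpen_ball.inter (isOpen_lt continuous_const continuous_im)
  have hBpm : MeasurableSet Bp := hBpo.measurableSet
  -- `B` is symmetric about the real axis
  have hconjB : ∀ z, z ∈ B → conj z ∈ B := by
    intro z hz
    rw [hB, mem_ball] at hz ⊢
    rwa [← conj_ofReal, dist_conj_conj]
  -- the unit `α` with `α e^{iθ} = i`
  set e : ℂ := Complex.exp (θ * Complex.I) with he
  have he0 : e ≠ 0 := exp_ne_zero _
  set α : ℂ := I / e with hα
  have hαe : α * e = I := div_mul_cancel₀ I he0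
  -- `f₁ = α H 1_{B⁺}`, its reflection `f₂`, and `f = f₁ + f₂`
  set H₁ : ℂ → ℂ := fun z => α * H z with hH₁
  set f₁ : ℂ → ℂ := Bp.indicator H₁ with hf₁
  set f₂ : ℂ → ℂ := fun z => conj (f₁ (conj z)) with hf₂
  set f : ℂ → ℂ := fun z => f₁ z + f₂ z with hf
  have hH₁i : IntegrableOn H₁ Bp := hHi.const_mul α
  have hf₁i : Integrable f₁ := hH₁i.integrable_indicator hBpm
  have hf₂i : Integrable f₂ := integrable_conj_comp_conj hf₁i
  have hfi : Integrable f := hf₁i.add hf₂i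
  -- `f = H₁` on `B⁺`
  have hfBp : ∀ z ∈ Bp, f z = H₁ z := by
    intro z hz
    have hz2 : 0 < z.im := hz.2
    have hz' : conj z ∉ Bp := by
      rintro ⟨-, h2⟩
      simp only [mem_setOf_eq, conj_im] at h2
      linarith
    simp only [hf, hf₂, hf₁, indicator_of_mem hz, indicator_of_notMem hz', map_zero, add_zero]
  -- pairing of `f₁` with a test function
  have hpair₁ : ∀ φ : ℂ → ℂ, ContDiff ℝ ∞ φ → HasCompactSupport φ → tsupport φ ⊆ B →
      ∫ z, f₁ z * dbarAlong 1 φ z = I * ∫ x : ℝ, φ (x : ℂ) ∂ν := by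
    intro φ hφ hφc hφs
    have h1 : (fun z => f₁ z * dbarAlong 1 φ z) =
        Bp.indicator (fun z => H₁ z * dbarAlong 1 φ z) := by
      ext z
      rw [hf₁]
      exact (indicator_mul_left Bp H₁ (dbarAlong 1 φ)).symm
    have h2 : ∫ z in Bp, H₁ z * dbarAlong 1 φ z = α * ∫ z in Bp, H z * dbarAlong 1 φ z := by
      rw [← integral_const_mul]
      congr 1
      ext z
      simp only [hH₁]
      ring
    rw [h1, integral_indicator hBpm, h2, hid φ hφ hφc hφs, ← mul_assoc, hαe]
  -- pairing of the reflection `f₂` with a test function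
  have hpair₂ : ∀ φ : ℂ → ℂ, ContDiff ℝ ∞ φ → HasCompactSupport φ → tsupport φ ⊆ B →
      ∫ z, f₂ z * dbarAlong 1 φ z = -(I * ∫ x : ℝ, φ (x : ℂ) ∂ν) := by
    intro φ hφ hφc hφs
    -- the reflected test function
    set φr : ℂ → ℂ := fun w => conj (φ (conj w)) with hφr
    have hφr_smooth : ContDiff ℝ ∞ φr :=
      conjCLE.contDiff.comp (hφ.comp conjCLE.contDiff)
    have hφr_cpt : HasCompactSupport φr :=
      (hφc.comp_homeomorph conjLIE.toHomeomorph).comp_left (g := fun z : ℂ => conj z) (map_zero _)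
    have hφr_supp : tsupport φr ⊆ B := by
      have hcl : IsClosed ((fun w : ℂ => conj w) ⁻¹' tsupport φ) :=
        (isClosed_tsupport φ).preimage continuous_conj
      have hsub : Function.support φr ⊆ (fun w : ℂ => conj w) ⁻¹' tsupport φ := by
        intro w hw
        rw [mem_preimage]
        by_contra h
        exact hw (by simp [hφr, image_eq_zero_of_notMem_tsupport h])
      intro w hw
      have hw' : conj w ∈ tsupport φ := closure_minimal hsub hcl hw
      simpa using hconjB _ (hφs hw')
    have hdbar : ∀ w, conj (dbarAlong 1 φ (conj w)) = dbarAlong 1 φr w := fun w =>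
      (dbarAlong_one_conj_comp_conj ((hφ.differentiable (by simp)).differentiableAt)).symm
    have hreal : ∀ x : ℝ, φr (x : ℂ) = conj (φ (x : ℂ)) := fun x => by
      simp only [hφr, conj_ofReal]
    calc ∫ z, f₂ z * dbarAlong 1 φ z
        = conj (∫ w, f₁ w * conj (dbarAlong 1 φ (conj w))) :=
          integral_conj_comp_conj_mul f₁ (dbarAlong 1 φ)
      _ = conj (∫ w, f₁ w * dbarAlong 1 φr w) := by simp_rw [hdbar]
      _ = conj (I * ∫ x : ℝ, φr (x : ℂ) ∂ν) := by rw [hpair₁ φr hφr_smooth hφr_cpt hφr_supp]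
      _ = conj (I * ∫ x : ℝ, conj (φ (x : ℂ)) ∂ν) := by simp_rw [hreal]
      _ = -(I * ∫ x : ℝ, φ (x : ℂ) ∂ν) := by
          rw [integral_conj, map_mul, conj_conj, conj_I, neg_mul]
  -- `∂̄ f = 0` in `D'(B)`
  have hweyl : ∀ φ : ℂ → ℂ, ContDiff ℝ ∞ φ → HasCompactSupport φ → tsupport φ ⊆ B →
      ∫ z, f z * dbarAlong 1 φ z = 0 := by
    intro φ hφ hφc hφs
    have hφ1 : ContDiff ℝ 1 φ := hφ.of_le (by exact_mod_cast le_top)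
    have hcont : Continuous (dbarAlong (1 : ℂ) φ) := continuous_dbarAlong hφ1 1
    have hcpt : HasCompactSupport (dbarAlong (1 : ℂ) φ) := hasCompactSupport_dbarAlong hφc 1
    obtain ⟨C, hC⟩ := hcont.bounded_above_of_compact_support hcpt
    have hi₁ : Integrable fun z => f₁ z * dbarAlong 1 φ z :=
      hf₁i.mul_bdd hcont.aestronglyMeasurable (Eventually.of_forall hC)
    have hi₂ : Integrable fun z => f₂ z * dbarAlong 1 φ z :=
      hf₂i.mul_bdd hcont.aestronglyMeasurable (Eventually.of_forall hC)
    have h1 : (fun z => f z * dbarAlong 1 φ z) =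
        fun z => f₁ z * dbarAlong 1 φ z + f₂ z * dbarAlong 1 φ z := by
      ext z
      simp only [hf]
      ring
    rw [h1, integral_add hi₁ hi₂, hpair₁ φ hφ hφc hφs, hpair₂ φ hφ hφc hφs, add_neg_cancel]
  obtain ⟨g, hg, hae⟩ := weyl_dbar hBo (hfi.locallyIntegrable.locallyIntegrableOn B) hweyl
  -- identification on `B⁺`
  have hH₁d : DifferentiableOn ℂ H₁ Bp := (differentiableOn_const α).mul hHd
  have hae' : H₁ =ᵐ[volume.restrict Bp] g := by
    rw [EventuallyEq, ae_restrict_iff' hBpm]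
    filter_upwards [hae] with z hz hzBp
    rw [← hfBp z hzBp, hz hzBp.1]
  have hEq : EqOn H₁ g Bp :=
    Measure.eqOn_open_of_ae_eq hae' hBpo hH₁d.continuousOn (hg.mono inter_subset_left).continuousOn
  have hβα : -I * e * α = 1 := by
    rw [mul_assoc, mul_comm e α, hαe, neg_mul, I_mul_I, neg_neg]
  refine ⟨fun z => -I * e * g z, (differentiableOn_const _).mul hg, fun z hz => ?_⟩
  simp only
  rw [← hEq hz, hH₁]
  simp only
  rw [← mul_assoc, hβα, one_mul]

end Summit.CriticalPhenomena.SAWScalingLimit.Theorems.PolygonParitySqueeze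

end
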